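import Literature.Probability.RandomPlanarGeometry.SLETwoPointFlowProofs
import Literature.Probability.RandomPlanarGeometry.SLERealFlowIto
import Literature.Probability.RandomPlanarGeometry.LoewnerBoundaryExtension
import HarnessLib

/-!
# The gap between the images of two real points on the same side of the driving point decreases

Topic `Literature/Probability/RandomPlanarGeometry`; theorems only.  Companion of
`SLETwoPointFlowProofs.lean` (`realFlow_sub_realFlow_mono`: the gap between points on OPPOSITE
sides of the driving point is non-decreasing).  For two real points `W₀ < y < y'` on the SAME side,
the gap `g_t(y') - g_t(y)` is NON-INCREASING as long as `y` is alive: its time derivative is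
`2/(g_t(y') - W_t) - 2/(g_t(y) - W_t) < 0` since `g_t(y') - W_t > g_t(y) - W_t > 0` (the real flow
preserves the order of real points, Lawler 2005 §4.1).  Consequence used by level-stopped boundary
observables: a gap of marks never exceeds its initial value, so the level box of the one-sided
crossing observables (`d < gap < x₂ - x₀ + 1`) is always left through the LOWER gap level.

* `realFlow_lt_realFlow_of_lt` — order preservation `X^y_t < X^{y'}_t` (for `t < T_y`;
  `map_ofReal_re_lt_of_lt`);
* `realFlow_sub_realFlow_antitone` — `X^{y'}_t - X^{y}_t ≤ X^{y'}_s - X^{y}_s` for `s ≤ t < T_y`;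
* `realFlowStop_sub_realFlowStop_le_sub` — `X^{y'}_t - X^{y}_t ≤ y' - y` while `y` is alive
  (frozen flows).

## References

* G. F. Lawler, *Conformally Invariant Processes in the Plane* (2005), Ch. 4, §4.1.  [Lawler2005]
-/

noncomputable section

open Set Filter Topology Complex
open scoped NNReal

namespace Literature.Probability.RandomPlanarGeometry

namespace Loewner

variable {W : ℝ≥0 → ℝ}

/-- **The real flow preserves the order of real points on the right of the driving point**:
for `W₀ < y < y'` and `t < T_y`, `realFlow W y t < realFlow W y' t`.
[cite: Lawler2005, Ch. 4 §4.1] -/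
theorem realFlow_lt_realFlow_of_lt (hW : Continuous W) {y y' : ℝ} (hy : W 0 < y) (hyy' : y < y')
    {t : ℝ≥0} (ht : (t : WithTop ℝ≥0) < swallowingTime W y) :
    realFlow W y t < realFlow W y' t := by
  have ht' : (t : WithTop ℝ≥0) < swallowingTime W y' :=
    lt_of_lt_of_le ht (swallowingTime_mono_right hW hy hyy'.le)
  rw [realFlow_apply, realFlow_apply]
  linarith [map_ofReal_re_lt_of_lt hW hy hyy' ht ht']

/-- **The gap between two real points on the same side of the driving point is non-increasing**:
for `W₀ < y < y'` and `s ≤ t < T_y`,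
`realFlow W y' t - realFlow W y t ≤ realFlow W y' s - realFlow W y s`.
[cite: Lawler2005, Ch. 4 §4.1] -/
theorem realFlow_sub_realFlow_antitone (hW : Continuous W) {y y' : ℝ} (hy : W 0 < y) (hyy' : y < y')
    {s t : ℝ≥0} (hst : s ≤ t) (ht : (t : WithTop ℝ≥0) < swallowingTime W y) :
    realFlow W y' t - realFlow W y t ≤ realFlow W y' s - realFlow W y s := by
  have hy' : W 0 < y' := hy.trans hyy'
  have ht' : (t : WithTop ℝ≥0) < swallowingTime W y' :=
    lt_of_lt_of_le ht (swallowingTime_mono_right hW hy hyy'.le)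
  have hyc : (y : ℂ) ≠ W 0 := fun h ↦ hy.ne' (by exact_mod_cast h)
  have hyc' : (y' : ℂ) ≠ W 0 := fun h ↦ hy'.ne' (by exact_mod_cast h)
  obtain ⟨g, hg⟩ := exists_isSolution_swallowingTime_holds hW hyc
  obtain ⟨g', hg'⟩ := exists_isSolution_swallowingTime_holds hW hyc'
  have hsy : (s : WithTop ℝ≥0) < swallowingTime W y := lt_of_le_of_lt (WithTop.coe_le_coe.2 hst) ht
  have hsy' : (s : WithTop ℝ≥0) < swallowingTime W y' := lt_of_le_of_lt (WithTop.coe_le_coe.2 hst) ht'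
  rw [realFlow_sub_realFlow, realFlow_sub_realFlow, map_eq_of_isSolution hW hg' hsy',
    map_eq_of_isSolution hW hg hsy, map_eq_of_isSolution hW hg' ht', map_eq_of_isSolution hW hg ht]
  -- the gap `q u = re (g' u) - re (g u)` is antitone on `[0, t]`
  set q : ℝ → ℝ := fun u ↦ (g' u).re - (g u).re with hq
  have htx : ((t : ℝ).toNNReal : WithTop ℝ≥0) < swallowingTime W y := by simpa using ht
  have htx' : ((t : ℝ).toNNReal : WithTop ℝ≥0) < swallowingTime W y' := by simpa using ht'
  have hsub := Icc_subset_timeDomain htx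
  have hsub' := Icc_subset_timeDomain htx'
  have hcont : ContinuousOn q (Icc 0 t) :=
    (continuous_re.comp_continuousOn (hg'.continuousOn.mono hsub')).sub
      (continuous_re.comp_continuousOn (hg.continuousOn.mono hsub))
  have hanti : AntitoneOn q (Icc 0 t) := by
    refine antitoneOn_of_hasDerivWithinAt_nonpos (convex_Icc (0 : ℝ) (t : ℝ)) hcont
      (f' := fun u ↦ 2 / ((g' u).re - W u.toNNReal) - 2 / ((g u).re - W u.toNNReal)) ?_ ?_
    · intro u hu
      rw [interior_Icc] at hu ⊢
      have hux : (u.toNNReal : WithTop ℝ≥0) < swallowingTime W y := (hsub ⟨hu.1.le, hu.2.le⟩).2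
      have hux' : (u.toNNReal : WithTop ℝ≥0) < swallowingTime W y' := (hsub' ⟨hu.1.le, hu.2.le⟩).2
      exact ((hg'.hasDerivAt_re hu.1 hux').sub (hg.hasDerivAt_re hu.1 hux)).hasDerivWithinAt
    · intro u hu
      rw [interior_Icc] at hu
      have hux : (u.toNNReal : WithTop ℝ≥0) < swallowingTime W y := (hsub ⟨hu.1.le, hu.2.le⟩).2
      have hux' : (u.toNNReal : WithTop ℝ≥0) < swallowingTime W y' := (hsub' ⟨hu.1.le, hu.2.le⟩).2
      -- both real flows are positive and ordered at time `u`
      have hX : 0 < (g u).re - W u.toNNReal := sub_pos.2 (hg.driving_lt_re hW hy hu.1.le hux)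
      have hord : (g u).re - W u.toNNReal < (g' u).re - W u.toNNReal := by
        have h1 := realFlow_lt_realFlow_of_lt hW hy hyy' (t := u.toNNReal) hux
        rwa [realFlow_eq_re_sub hW hg hux, realFlow_eq_re_sub hW hg' hux',
          Real.coe_toNNReal _ hu.1.le] at h1
      have hX' : 0 < (g' u).re - W u.toNNReal := hX.trans hord
      have : 2 / ((g' u).re - W u.toNNReal) ≤ 2 / ((g u).re - W u.toNNReal) :=
        div_le_div_of_nonneg_left (by norm_num) hX hord.le
      linarith
  have := hanti ⟨s.coe_nonneg, NNReal.coe_le_coe.2 hst⟩ ⟨t.coe_nonneg, le_rfl⟩ (NNReal.coe_le_coe.2 hst)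
  simpa [hq] using this

/-- **A gap of marks never exceeds its initial value** (frozen flows): for `W₀ < y < y'` and
`t < T_y`, `realFlowStop W y' t - realFlowStop W y t ≤ y' - y`. [cite: Lawler2005, Ch. 4 §4.1] -/
theorem realFlowStop_sub_realFlowStop_le_sub (hW : Continuous W) {y y' : ℝ} (hy : W 0 < y)
    (hyy' : y < y') {t : ℝ≥0} (ht : (t : WithTop ℝ≥0) < swallowingTime W y) :
    realFlowStop W y' t - realFlowStop W y t ≤ y' - y := by
  have ht' : (t : WithTop ℝ≥0) < swallowingTime W y' :=
    lt_of_lt_of_le ht (swallowingTime_mono_right hW hy hyy'.le)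
  have h := realFlow_sub_realFlow_antitone hW hy hyy' (zero_le : (0 : ℝ≥0) ≤ t) ht
  rw [realFlow_zero hW hy.ne', realFlow_zero hW (hy.trans hyy').ne'] at h
  rw [realFlowStop_of_lt ht, realFlowStop_of_lt ht']
  linarith

end Loewner

end Literature.Probability.RandomPlanarGeometry

end
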